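import Summits.AtomisticToContinuum.HydrodynamicLimit.Theorems.CollisionIsometryCLTMacroClosureEngineDefs
import Summits.AtomisticToContinuum.HydrodynamicLimit.Theorems.CollisionIsometryCLTMacroClosureStubBalanceB3
import Summits.AtomisticToContinuum.HydrodynamicLimit.Theorems.CollisionIsometryCLTMacroClosureStubBalanceB4
import Literature.Analysis.FunctionSpaces.TorusSpaceTime
import HarnessLib

/-!
# Sub-goal `engine_obsCommutator` of the lead's stub `stub_engine` (line `IdeatorTwoGen1Sketch`, crux
# `MacroClosure`, stmt-AtomisticToContinuum-14870): the observable commutator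

For a classical hs-Euler solution in the dilute chamber of `ThermoChamber` and `0 < t < T` there is a
constant `C ≥ 0` (depending only on the solution and on `t`) such that for every smooth kernel `φ ≥ 0`
of unit mass supported in the minimal-image ball `{euclidDist(·, 0) < r}`, every configuration `w` and
every `s ∈ [0, t]`,
`|∫ₓ Λ_cl(s,x)·Ū(w,x) dx − Obs(s,w)| ≤ C r ⟨emp w, 1 + |v|²⟩`.

Proof. By clause 3 of `ThermoChamber`, `Λ_cl(s,x) V = λ⁰(s,x) V.1 + ⟪λᵐ(s,x), V.2.1⟫ + λᴱ(s,x) V.2.2`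
with the entropy variables `λ⁰ = lam0`, `λᵐ = lamM = θ⁻¹u`, `λᴱ = lamE = −θ⁻¹`, all jointly smooth on
`[0, T) × T³`; hence `∫ₓ Λ_cl·Ū = ∫ₓ λ⁰ρ̄ + Σⱼ ∫ₓ λᵐⱼ m̄ⱼ + ∫ₓ λᴱ Ē` with the block fields
`ρ̄ = ⟨emp, φ(·−x)⟩`, `m̄ⱼ = ⟨emp, φ(·−x) vⱼ⟩`, `Ē = ⟨emp, φ(·−x)|v|²/2⟩`, while
`Obs = ⟨emp, λ⁰⟩ + Σⱼ ⟨emp, λᵐⱼ vⱼ⟩ + ⟨emp, λᴱ |v|²/2⟩`. Each of the five differences is a mollifier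
commutator of conjunct (B4) of `BalanceIdentity` (`stub_balance_B4`) with the weights `λ⁰(s,·)`,
`λᵐⱼ(s,·)`, `λᴱ(s,·)`, whose torus gradients are bounded on the compact `[0, t] × T³` by a constant `L`
(joint smoothness of gradients, `IsSmoothSpaceTimeOn.exists_norm_le_of_isCompact`); the velocity weights
`1, vⱼ, |v|²/2` have total modulus `≤ 3(1 + |v|²)`, whence `C = 3L`.
-/

noncomputable section

open MeasureTheory Filter Set Topology InformationTheory
open scoped ENNReal ContDiff

namespace Summit.AtomisticToContinuum.HydrodynamicLimit.Theorems.MacroClosureLine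

open Literature.MathematicalPhysics.KineticTheory Literature.Analysis.FluidPDE
open Literature.Analysis.FunctionSpaces

namespace Barycentric

namespace ObsCommutator

/-- A kernel of unit mass supported in `{euclidDist(·, 0) < r}` forces `0 < r`. -/
theorem radius_pos {φ : T3 → ℝ} {r : ℝ} (hφ1 : ∫ y, φ y = 1)
    (hsupp : ∀ y, r ≤ Torus.euclidDist y 0 → φ y = 0) : 0 < r := by
  by_contra h
  have h0 : ∀ y, φ y = 0 := fun y =>
    hsupp y ((not_lt.1 h).trans (by rw [Torus.euclidDist_eq]; exact norm_nonneg _))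
  simp [h0] at hφ1

/-- The velocity weights `1, vⱼ, |v|²/2` have total modulus at most `3 (1 + |v|²)`. -/
theorem velocity_weights_le (v : V3) :
    |(1 : ℝ)| + (∑ j, |v j|) + |‖v‖ ^ 2 / 2| ≤ 3 * (1 + ‖v‖ ^ 2) := by
  have hj : ∀ j, |v j| ≤ (1 + ‖v‖ ^ 2) / 2 := fun j => by
    have h1 : |v j| ≤ ‖v‖ := by simpa using PiLp.norm_apply_le v j
    nlinarith [sq_nonneg (‖v‖ - 1), norm_nonneg v]
  have hs : ∑ j, |v j| ≤ 3 * ((1 + ‖v‖ ^ 2) / 2) := by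
    calc ∑ j, |v j| ≤ ∑ _j : Fin 3, (1 + ‖v‖ ^ 2) / 2 := Finset.sum_le_sum fun j _ => hj j
      _ = 3 * ((1 + ‖v‖ ^ 2) / 2) := by simp
  rw [abs_one, abs_of_nonneg (by positivity : (0 : ℝ) ≤ ‖v‖ ^ 2 / 2)]
  nlinarith [norm_nonneg v]

variable {n : ℕ}

/-- The block functional `x ↦ wt x · ⟨emp w, φ(· − x) g⟩` of a continuous weight and a continuous kernel
is integrable on the torus (a finite sum of continuous functions on a compact space). -/
theorem integrable_weight_block {wt φ : T3 → ℝ} (hwt : Continuous wt) (hφ : Continuous φ)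
    (g : V3 → ℝ) (w : Config (n + 1) (Fin 3) T3) :
    Integrable (fun x => wt x * ∫ y, φ (y.1 - x) * g y.2 ∂(empiricalMeasure w)) := by
  simp only [integral_empiricalMeasure]
  refine Continuous.integrable_unitAddTorus (hwt.mul (continuous_const.mul ?_))
  exact continuous_finsetSum _ fun i _ =>
    (hφ.comp (continuous_const.sub continuous_id)).mul continuous_const

end ObsCommutator

/-! ## The sub-goal -/

/-- **`engine_obsCommutator` (registered sub-goal S3b of `stub_engine`): the observable commutator.**
`∫ₓ Λ_cl(s,x)·Ū(w,x) dx` and the tested observable `Obs(s,w)` differ by at most `C r ⟨emp w, 1 + |v|²⟩`,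
uniformly in the configuration `w`, the kernel (smooth, `≥ 0`, unit mass, radius `r`) and `s ∈ [0, t]`:
five mollifier commutators (B4) with the entropy variables of `ThermoChamber` clause 3 as weights. -/
theorem engine_obsCommutator : ∀ (σ : ℝ), 0 < σ → ∀ (T : ℝ) (ρ θ : ℝ → T3 → ℝ) (u : ℝ → T3 → V3),
    IsHardSphereEulerSolution σ T ρ u θ → ∀ η₃ : ℝ, ThermoChamber η₃ →
    (∀ s ∈ Ico 0 T, ∀ x, ρ s x * σ ^ 3 < η₃) → ∀ t : ℝ, 0 < t → t < T →
    ∃ C : ℝ, 0 ≤ C ∧ ∀ (n : ℕ) (φ : T3 → ℝ) (r : ℝ), Torus.IsSmooth φ → (∀ y, 0 ≤ φ y) →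
      ∫ y, φ y = 1 → (∀ y, r ≤ Torus.euclidDist y 0 → φ y = 0) →
      ∀ (w : Config (n + 1) (Fin 3) T3), ∀ s ∈ Icc 0 t,
        |(∫ x, Lcl σ ρ θ u s x (bU φ w x)) - obs σ ρ θ u s w| ≤
          C * r * ∫ y, (1 + ‖y.2‖ ^ 2) ∂(empiricalMeasure w) := by
  intro σ hσ T ρ θ u hE η₃ hT hpack t ht htT
  -- clause 3 of `ThermoChamber`: `Λ = Dη_σ(U_cl)` is jointly smooth with explicit form
  obtain ⟨hΛ, hΛeq, -, -⟩ := (hT σ hσ).2.2 T ρ θ u hE hpack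
  have hinner : ∀ a b : V3, inner ℝ a b = ∑ j, a j * b j := fun a b => by
    rw [PiLp.inner_apply]
    exact Finset.sum_congr rfl fun j _ => by rw [RCLike.inner_apply, conj_trivial, mul_comm]
  have hL : ∀ s ∈ Ico 0 T, ∀ (x : T3) (V : State), Lcl σ ρ θ u s x V =
      lam0 σ ρ θ u s x * V.1 + (∑ j, lamM θ u s x j * V.2.1 j) + lamE θ s x * V.2.2 := by
    intro s hs x V
    have h := hΛeq s hs x V
    rw [← hinner]
    simp only [Lcl, Ucl, lam0, lamM, lamE]
    rw [h]
    ring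
  -- smoothness of the entropy variables on `[0, T) × T³`
  have h0 : Torus.IsSmoothSpaceTimeOn (Ico 0 T) (lam0 σ ρ θ u) := by
    refine (hΛ.clm_comp (ContinuousLinearMap.apply ℝ ℝ (((1 : ℝ), ((0 : V3), (0 : ℝ))) : State))).congr ?_
    rintro ⟨s, y⟩ hp
    have hs : s ∈ Ico 0 T := (mem_prod.1 hp).1
    simp only [Torus.stLift_apply, ContinuousLinearMap.apply_apply]
    rw [hΛeq s hs]
    simp [lam0]
  have hθinv : Torus.IsSmoothSpaceTimeOn (Ico 0 T) (fun s x => (θ s x)⁻¹) :=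
    ContDiffOn.inv hE.smooth_temperature fun p hp =>
      (hE.temperature_pos p.1 (mem_prod.1 hp).1 (Torus.proj p.2)).ne'
  have hM : ∀ j, Torus.IsSmoothSpaceTimeOn (Ico 0 T) (fun s x => lamM θ u s x j) := fun j =>
    (hθinv.smul hE.smooth_velocity).apply j
  have hEE : Torus.IsSmoothSpaceTimeOn (Ico 0 T) (lamE θ) := hθinv.neg
  -- uniform gradient bounds on the compact `[0, t] × T³`
  have hU : UniqueDiffOn ℝ (Ico (0 : ℝ) T) := uniqueDiffOn_Ico 0 T
  have hK : IsCompact (Icc (0 : ℝ) t) := isCompact_Icc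
  have hKS : Icc (0 : ℝ) t ⊆ Ico 0 T := Icc_subset_Ico_right htT
  obtain ⟨L0, hL0⟩ := (h0.gradient hU).exists_norm_le_of_isCompact hK hKS
  have hLMex : ∀ j, ∃ C : ℝ, ∀ s ∈ Icc (0 : ℝ) t, ∀ x,
      ‖Torus.gradient (fun x => lamM θ u s x j) x‖ ≤ C := fun j =>
    ((hM j).gradient hU).exists_norm_le_of_isCompact hK hKS
  choose LM hLM using hLMex
  obtain ⟨LE, hLE⟩ := (hEE.gradient hU).exists_norm_le_of_isCompact hK hKS
  obtain ⟨L, hL0L, hLEL, hLML, hLnn⟩ : ∃ L : ℝ, |L0| ≤ L ∧ |LE| ≤ L ∧ (∀ j, |LM j| ≤ L) ∧ 0 ≤ L := by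
    have hs : 0 ≤ ∑ j, |LM j| := Finset.sum_nonneg fun j _ => abs_nonneg _
    have h1 : ∀ j, |LM j| ≤ ∑ k, |LM k| := fun j =>
      Finset.single_le_sum (f := fun k => |LM k|) (fun k _ => abs_nonneg _) (Finset.mem_univ j)
    refine ⟨|L0| + |LE| + ∑ j, |LM j|, ?_, ?_, fun j => (h1 j).trans ?_, by positivity⟩
    · linarith [abs_nonneg LE]
    · linarith [abs_nonneg L0]
    · linarith [abs_nonneg L0, abs_nonneg LE]
  have hL0' : ∀ s ∈ Icc (0 : ℝ) t, ∀ x, ‖Torus.gradient (lam0 σ ρ θ u s) x‖ ≤ L := fun s hs x =>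
    ((hL0 s hs x).trans (le_abs_self _)).trans hL0L
  have hLE' : ∀ s ∈ Icc (0 : ℝ) t, ∀ x, ‖Torus.gradient (lamE θ s) x‖ ≤ L := fun s hs x =>
    ((hLE s hs x).trans (le_abs_self _)).trans hLEL
  have hLM' : ∀ j, ∀ s ∈ Icc (0 : ℝ) t, ∀ x, ‖Torus.gradient (fun x => lamM θ u s x j) x‖ ≤ L :=
    fun j s hs x => ((hLM j s hs x).trans (le_abs_self _)).trans (hLML j)
  refine ⟨3 * L, by positivity, ?_⟩
  intro n φ r hφ hφ0 hφ1 hsupp w s hs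
  have hsT : s ∈ Ico 0 T := hKS hs
  have hr : 0 < r := ObsCommutator.radius_pos hφ1 hsupp
  set μ := empiricalMeasure w with hμ
  -- the five commutators (B4)
  have hB4 := stub_balance_B4 n φ r L hφ0 hφ.integrable hφ1 hsupp
  have c0 := hB4 (lam0 σ ρ θ u s) (h0.isSmooth_slice hsT) (hL0' s hs) (fun _ => (1 : ℝ)) w
  have cM : ∀ j : Fin 3, |(∫ y, lamM θ u s y.1 j * y.2 j ∂μ) -
      ∫ x, lamM θ u s x j * ∫ y, φ (y.1 - x) * y.2 j ∂μ| ≤ r * L * ∫ y, |y.2 j| ∂μ := fun j =>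
    hB4 (fun x => lamM θ u s x j) ((hM j).isSmooth_slice hsT) (hLM' j s hs) (fun v => v j) w
  have cE := hB4 (lamE θ s) (hEE.isSmooth_slice hsT) (hLE' s hs) (fun v => ‖v‖ ^ 2 / 2) w
  -- the two sides as sums of the five functionals
  have hobs : obs σ ρ θ u s w = (∫ y, lam0 σ ρ θ u s y.1 * 1 ∂μ) +
      (∑ j, ∫ y, lamM θ u s y.1 j * y.2 j ∂μ) + ∫ y, lamE θ s y.1 * (‖y.2‖ ^ 2 / 2) ∂μ := by
    simp only [obs, hμ, integral_empiricalMeasure, mul_one]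
    rw [← Finset.mul_sum, Finset.sum_comm, ← mul_add, ← mul_add, ← Finset.sum_add_distrib,
      ← Finset.sum_add_distrib]
  have hblock : ∫ x, Lcl σ ρ θ u s x (bU φ w x) =
      (∫ x, lam0 σ ρ θ u s x * ∫ y, φ (y.1 - x) * 1 ∂μ) +
      (∑ j, ∫ x, lamM θ u s x j * ∫ y, φ (y.1 - x) * y.2 j ∂μ) +
      ∫ x, lamE θ s x * ∫ y, φ (y.1 - x) * (‖y.2‖ ^ 2 / 2) ∂μ := by
    have hpt : ∀ x, Lcl σ ρ θ u s x (bU φ w x) =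
        lam0 σ ρ θ u s x * (∫ y, φ (y.1 - x) * 1 ∂μ) +
        (∑ j, lamM θ u s x j * ∫ y, φ (y.1 - x) * y.2 j ∂μ) +
        lamE θ s x * ∫ y, φ (y.1 - x) * (‖y.2‖ ^ 2 / 2) ∂μ := by
      intro x
      rw [hL s hsT x]
      simp only [bU, bρ, bE, empiricalDensityField, empiricalEnergyField, mul_one, hμ,
        bm_apply_eq_sum, integral_weight_mul_eq_sum]
    simp_rw [hpt]
    have hc : Continuous φ := hφ.continuous
    have i0 : Integrable (fun x => lam0 σ ρ θ u s x * ∫ y, φ (y.1 - x) * 1 ∂μ) :=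
      ObsCommutator.integrable_weight_block (h0.isSmooth_slice hsT).continuous hc (fun _ => (1 : ℝ)) w
    have iM : ∀ j : Fin 3, Integrable (fun x => lamM θ u s x j * ∫ y, φ (y.1 - x) * y.2 j ∂μ) :=
      fun j => ObsCommutator.integrable_weight_block ((hM j).isSmooth_slice hsT).continuous hc
        (fun v => v j) w
    have iS : Integrable (fun x => ∑ j, lamM θ u s x j * ∫ y, φ (y.1 - x) * y.2 j ∂μ) :=
      integrable_finsetSum _ fun j _ => iM j
    have iE : Integrable (fun x => lamE θ s x * ∫ y, φ (y.1 - x) * (‖y.2‖ ^ 2 / 2) ∂μ) :=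
      ObsCommutator.integrable_weight_block (hEE.isSmooth_slice hsT).continuous hc
        (fun v => ‖v‖ ^ 2 / 2) w
    have i0S : Integrable (fun x => lam0 σ ρ θ u s x * (∫ y, φ (y.1 - x) * 1 ∂μ) +
        ∑ j, lamM θ u s x j * ∫ y, φ (y.1 - x) * y.2 j ∂μ) := i0.add iS
    rw [integral_add i0S iE, integral_add i0 iS, integral_finsetSum _ fun j _ => iM j]
  -- the total velocity weight
  have hg : (∫ y, |(1 : ℝ)| ∂μ) + (∑ j, ∫ y, |y.2 j| ∂μ) + ∫ y, |‖y.2‖ ^ 2 / 2| ∂μ ≤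
      3 * ∫ y, (1 + ‖y.2‖ ^ 2) ∂μ := by
    simp only [hμ, integral_empiricalMeasure]
    rw [← Finset.mul_sum, Finset.sum_comm, ← mul_add, ← mul_add, ← Finset.sum_add_distrib,
      ← Finset.sum_add_distrib, mul_left_comm]
    refine mul_le_mul_of_nonneg_left ?_ (inv_nonneg.2 (Nat.cast_nonneg _))
    rw [Finset.mul_sum]
    exact Finset.sum_le_sum fun i _ => ObsCommutator.velocity_weights_le (w i).2
  -- assembly
  rw [hobs, hblock, abs_sub_comm]
  have e : (∫ y, lam0 σ ρ θ u s y.1 * 1 ∂μ) + (∑ j, ∫ y, lamM θ u s y.1 j * y.2 j ∂μ) +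
        (∫ y, lamE θ s y.1 * (‖y.2‖ ^ 2 / 2) ∂μ) -
      ((∫ x, lam0 σ ρ θ u s x * ∫ y, φ (y.1 - x) * 1 ∂μ) +
        (∑ j, ∫ x, lamM θ u s x j * ∫ y, φ (y.1 - x) * y.2 j ∂μ) +
        ∫ x, lamE θ s x * ∫ y, φ (y.1 - x) * (‖y.2‖ ^ 2 / 2) ∂μ) =
      ((∫ y, lam0 σ ρ θ u s y.1 * 1 ∂μ) - ∫ x, lam0 σ ρ θ u s x * ∫ y, φ (y.1 - x) * 1 ∂μ) +
      (∑ j, ((∫ y, lamM θ u s y.1 j * y.2 j ∂μ) -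
        ∫ x, lamM θ u s x j * ∫ y, φ (y.1 - x) * y.2 j ∂μ)) +
      ((∫ y, lamE θ s y.1 * (‖y.2‖ ^ 2 / 2) ∂μ) -
        ∫ x, lamE θ s x * ∫ y, φ (y.1 - x) * (‖y.2‖ ^ 2 / 2) ∂μ) := by
    rw [Finset.sum_sub_distrib]
    ring
  rw [e]
  have hrL : 0 ≤ r * L := mul_nonneg hr.le hLnn
  calc |((∫ y, lam0 σ ρ θ u s y.1 * 1 ∂μ) - ∫ x, lam0 σ ρ θ u s x * ∫ y, φ (y.1 - x) * 1 ∂μ) +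
        (∑ j, ((∫ y, lamM θ u s y.1 j * y.2 j ∂μ) -
          ∫ x, lamM θ u s x j * ∫ y, φ (y.1 - x) * y.2 j ∂μ)) +
        ((∫ y, lamE θ s y.1 * (‖y.2‖ ^ 2 / 2) ∂μ) -
          ∫ x, lamE θ s x * ∫ y, φ (y.1 - x) * (‖y.2‖ ^ 2 / 2) ∂μ)|
      ≤ |(∫ y, lam0 σ ρ θ u s y.1 * 1 ∂μ) - ∫ x, lam0 σ ρ θ u s x * ∫ y, φ (y.1 - x) * 1 ∂μ| +
        (∑ j, |(∫ y, lamM θ u s y.1 j * y.2 j ∂μ) -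
          ∫ x, lamM θ u s x j * ∫ y, φ (y.1 - x) * y.2 j ∂μ|) +
        |(∫ y, lamE θ s y.1 * (‖y.2‖ ^ 2 / 2) ∂μ) -
          ∫ x, lamE θ s x * ∫ y, φ (y.1 - x) * (‖y.2‖ ^ 2 / 2) ∂μ| :=
        (abs_add_three _ _ _).trans (by gcongr; exact Finset.abs_sum_le_sum_abs _ _)
    _ ≤ r * L * (∫ y, |(1 : ℝ)| ∂μ) + (∑ j, r * L * ∫ y, |y.2 j| ∂μ) +
        r * L * ∫ y, |‖y.2‖ ^ 2 / 2| ∂μ :=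
        add_le_add_three c0 (Finset.sum_le_sum fun j _ => cM j) cE
    _ = r * L * ((∫ y, |(1 : ℝ)| ∂μ) + (∑ j, ∫ y, |y.2 j| ∂μ) + ∫ y, |‖y.2‖ ^ 2 / 2| ∂μ) := by
        rw [← Finset.mul_sum]
        ring
    _ ≤ r * L * (3 * ∫ y, (1 + ‖y.2‖ ^ 2) ∂μ) := mul_le_mul_of_nonneg_left hg hrL
    _ = 3 * L * r * ∫ y, (1 + ‖y.2‖ ^ 2) ∂μ := by ring

end Barycentric

end Summit.AtomisticToContinuum.HydrodynamicLimit.Theorems.MacroClosureLine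

end
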